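import Mathlib
import Summits.CriticalPhenomena.Ising3DConformalLimit.Theses.PrecisionLaplacian
import Summits.CriticalPhenomena.Ising3DConformalLimit.Theses.BernsteinTemperature
import Summits.CriticalPhenomena.Ising3DConformalLimit.Theses.PrimaryAtInfinity
import Summits.CriticalPhenomena.Ising3DConformalLimit.Theses.PerfectScreening
import Summits.CriticalPhenomena.Ising3DConformalLimit.Theses.WeylWindow
import Summits.CriticalPhenomena.Ising3DConformalLimit.Theses.IsingEuclidUpgrade
import Summits.CriticalPhenomena.Ising3DConformalLimit.Theorems.PrecisionLaplacianMoebiusLimitOfTwoPointLawMultipoleEdge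
import Summits.CriticalPhenomena.Ising3DConformalLimit.Theorems.PrecisionLaplacianMoebiusLimitOfTwoPointLawInversionBegetsRotations
import Summits.CriticalPhenomena.Ising3DConformalLimit.Theorems.PrecisionLaplacianMoebiusLimitOfTwoPointLawReflectInvertOfSCT
import Summits.CriticalPhenomena.Ising3DConformalLimit.Theorems.PrecisionLaplacianMoebiusLimitOfTwoPointLawScaleOfSCT
import Summits.CriticalPhenomena.Ising3DConformalLimit.Theorems.PrecisionLaplacianMoebiusLimitOfTwoPointLawInversionOfReflectInvert
import Summits.CriticalPhenomena.Ising3DConformalLimit.Theorems.PrecisionLaplacianMoebiusLimitOfTwoPointLawFarFieldCoeffContinuous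
import Summits.CriticalPhenomena.Ising3DConformalLimit.Theorems.PrecisionLaplacianMoebiusLimitOfTwoPointLawSCTOfWard
import Summits.CriticalPhenomena.Ising3DConformalLimit.Theorems.PrecisionLaplacianMoebiusLimitOfTwoPointLawMultipoleToWardOfContinuous
import Summits.CriticalPhenomena.Ising3DConformalLimit.Theorems.PrecisionLaplacianMoebiusLimitOfTwoPointLawRegularOfLimitExists
import Summits.CriticalPhenomena.Ising3DConformalLimit.Theorems.PrecisionLaplacianMoebiusLimitOfTwoPointLawBareFactorisation
import Summits.CriticalPhenomena.Ising3DConformalLimit.Theorems.PrecisionLaplacianMoebiusLimitOfTwoPointLawLimitExistsEdge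
import HarnessLib

/-!
# Line `multipole-ward-nonsat-endpoint` — skeleton v3.1 (lead c3; v3 = lead c2; v2 = lead c1) for crux stmt-CriticalPhenomena-4801
# `PrecisionLaplacian.MoebiusLimitOfTwoPointLaw` (= `BernsteinTemperature.MoebiusLimitOfTwoPointLaw`)

Crux (by name): item 0634 (isotropic two-point power law on `ℤ³`) → item 1344 (non-degenerate Möbius-covariant
pointwise scaling limit of `criticalCorr 3`).

THE LINE (planner card `Lines/multipole-ward-nonsat-endpoint.md`): the crux is a corollary of route PrimaryAtInfinity.
Its dependency edge `moebiusLimitOfTwoPointLaw_of_primaryAtInfinity : NonSaturation → ExistsRegularLimit →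
FirstMultipoleIdentity → FarFieldClustering → MultipoleToWard → WardToMoebius → crux` is LANDED (p92525,
`Theorems/PrecisionLaplacianMoebiusLimitOfTwoPointLawMultipoleEdge.lean`, glue B1 p70472 + B2 inside). The four
open-problem items (1342 `NonSaturation`, 5355 `ExistsRegularLimit`, 5352 `FirstMultipoleIdentity`, 5353
`FarFieldClustering`) enter `MoebiusLimitOfTwoPointLaw_of` BY NAME as hypotheses (no worker is spent on them); what this
lead BUILDS is the provable-now analysis half of the edge:

* item 5356 `PrimaryAtInfinity.MultipoleToWard` (first multipole + clustering ⇒ weak special-conformal Ward identity),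
  as `stub_multipoleToWard` (sorry-free glue) over two registered stubs: `stub_farFieldCoeffContinuous` (S5a: the
  far-field coefficients are continuous off the diagonals, from the expansion clause) and
  `stub_multipoleToWardOfContinuous` (S5b: the `φ(x)χ_L(z)`, `L → ∞` argument with honest Fubini);
* item 5357 `PrimaryAtInfinity.WardToMoebius` (weak SCT Ward identities + translations + parity + continuity ⇒
  `IsMoebiusCovariant Δ S`), RESHAPED into four registered stubs composed by `wardToMoebius_of_stubs` (sorry-free) with
  the LANDED group lemma A0 (`stub_inversionBegetsRotations`, item 4675, p86170):
  - `stub_sctOfWard` (LEAD; the analysis core): the weak `K_b`-identity integrates to covariance of `S` under the finite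
    special conformal maps `x ↦ (x + ‖x‖²a)/(1 + 2⟪a,x⟫ + ‖a‖²‖x‖²)` along pole-free paths, with weight
    `∏ (1 + 2⟪a,xᵢ⟫ + ‖a‖²‖xᵢ‖²)^Δ`. Mechanism: `K = ιPι` — for `T := ∏‖yᵢ‖^{-2Δ} S∘ι` on `({0}ᶜ)ⁿ` the `K_a`-identity
    of `S` tested against `∏‖xⱼ‖^{2Δ−6} ψ(ιx)` IS the weak translation identity `∫ T (a·∇ψ) = 0` (chain rule:
    `Dι(x)[‖x‖²a − 2⟪a,x⟫x] = a`, `W_a·∇ ∏‖xⱼ‖^{2Δ−6} = −(2Δ−6)(Σ⟪a,xⱼ⟫)∏‖xⱼ‖^{2Δ−6}`; n-fold change of variables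
    `setIntegral_comp_prodSphereInversion`, landed p91630), which integrates along segments (no poles!) to
    `T(y + a) = T(y)`; read back through `ι` this is the displayed SCT covariance (`ι(ιx + a) = SCT_a x`,
    `‖ιx + a‖² = σ_a(x)/‖x‖²`).
  - `stub_reflectInvertOfSCT`: translations + SCT ⇒ covariance under `J_b := τ_{−b} ∘ SCT_b ∘ τ_{−b} = ι ∘ R_b`
    (`R_b` = reflection in `b^⊥`, `‖b‖ = 1`): `S(R_b y/‖y‖²) = ∏‖yᵢ‖^{2Δ} S(y)` off the ray `ℝ≤0·b` and the point `b`.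
  - `stub_scaleOfSCT`: dilations are words — `D_{λ²} = τ_{λb} ∘ SCT_{−b/λ} ∘ τ_{(λ−1)b} ∘ SCT_b ∘ τ_{−b}` (orbit of a
    point `x`: `x − b`, `b + R_b(x/‖x‖²)`, `λb + R_b(x/‖x‖²)`, `λ²x − λb`, `λ²x`; weights `‖x‖²` and `1/(λ²‖x‖²)`),
    poles (all on the line `ℝb`) dodged by a translation ⇒ `IsScaleCovariant Δ S`.
  - `stub_inversionOfReflectInvert`: `ι ∘ (−1) = J_b ∘ J_w ∘ J_{w'}` for an orthonormal frame `{b, w, w'}` chosen with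
    `⟪xᵢ,b⟫ ≠ 0`, `b ∉ ℝxᵢ` (weights `∏‖xᵢ‖^{2Δ}·∏‖xᵢ‖^{-2Δ}·∏‖xᵢ‖^{2Δ}`), parity ⇒ `IsInversionCovariant Δ S`; then `O(3)`
    from A0 (translations + inversion ⇒ rotations, Cartan–Dieudonné inside).
  No flow ODE, no second-derivative commutator calculus: `[K,P] ∋ D, M` is replaced by explicit words in the group
  generated by translations and SCTs (`⟨P, K⟩ = so(4,1)`, LuscherMack1975), parity supplying the second component.

Disproof.lean (cdisprove v12, 2026-08-16T00:42Z; NO `_false_without_` theorems, NO `-- Targets` section) honoured: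
`cruxWithoutPosC_iff` — `0 < c` is consumed inside the landed edge (B1 `twoPointLaw_exponent_gt_half_of_nonSaturation`,
B2 `twoPoint_of_limit`); `not_modelBlindCrux` / isotropy — nothing here is model-blind: 5352/5353/5355 quantify over
limits OF `criticalCorr 3`, 1342 over `criticalTwoPoint 3`, and the stubs below are pure analysis on `CorrFamily 3`
(true for every family, so no lattice witness can refute them); `crux_iff_even_sharper` — (a) = `hE` (5355), (b)
`O(3)` and (c) unit inversion are OUTPUT of the Ward identities (stub G3 + landed A0); `not_groupLemmaWithoutTranslation`
— translation invariance is a hypothesis of 5357 and is load-bearing below (pole dodging, the `D`/`ι` words, A0). Landed `Negative/*`: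
none states the negation of a stub instance (they concern the crux's structure and other cards).

Lead c1 = `prover-line-stmt-CriticalPhenomena-4801-c1-0`, 2026-08-16. Previous lead's line `two-shell-exchange-markov`
ended `promote-stub stub_lawLevelReversal` (all its provable stubs landed); see `PICKED.md`.

LEAD STATUS (cycle 1, 2026-08-16 ~13:40Z): ALL SIX REGISTERED STUBS LANDED (wave 1 of 5 workers + the lead's stub A) —
`stub_reflectInvertOfSCT` p97832, `stub_scaleOfSCT` p99350, `stub_inversionOfReflectInvert` p98963,
`stub_farFieldCoeffContinuous` p97822, `stub_sctOfWard` p100147 (+ helper `sctA_weak_translation` p99182),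
`stub_multipoleToWardOfContinuous` p105438 (+ Aux p101507, Aux2 p102330). Item 5357 `WardToMoebius` CLOSED proved by
`PrecisionLaplacianMoebiusLimitOfTwoPointLaw.wardToMoebius` (p101474); item 5356 `MultipoleToWard` by `…multipoleToWard` (p105936).
This file is now sorry-free: the crux follows from the four OPEN items 1342/5355/5352/5353 BY NAME
(`moebiusLimitOfTwoPointLaw_of_open_items`, `Theorems/…OpenItemsEdge.lean`).

LEAD c2 (`prover-line-stmt-CriticalPhenomena-4801-c2-0`, 2026-08-16 ~16:30Z) — RESHAPE v3, the existence hypothesis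
made minimal: item 5355 `ExistsRegularLimit` is traded for item stmt-CriticalPhenomena-4738 `WeylWindow.LimitExists`
(BARE existence of a non-degenerate pointwise scaling limit — the weakest existence item of the sub-problem, and a
NECESSARY condition for the crux's conclusion: `limitExists_of_crux` below) through ONE new registered stub
`stub_regularOfLimitExists : LimitExists → ExistsRegularLimit` (normalisation, translation invariance, parity and
continuity of a limit of `criticalCorr 3` are automatic: truncation + the landed free-symmetry lemmas
`MoebiusLimitExistsNegative.limit_translate` / `limit_neg` and `LimitMeshContinuity.continuousOn_limit`), and item
1342 `NonSaturation` is dropped via lead 1's landed `_sharp` edge (p101387). Composition: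
`MoebiusLimitOfTwoPointLaw_of : LimitExists → FirstMultipoleIdentity → FarFieldClustering → crux` — the crux now
rests on 4738 (necessary) and the two Ward-content items 5352/5353 only.

LEAD c3 (`prover-line-stmt-CriticalPhenomena-4801-c3-0`, 2026-08-16 ~18:30Z) — v3.1, NO reshape (there is no open stub
left to reshape or wave): the skeleton now also imports the two tree theorems lead c2 landed after v3 was published and
re-exports them in line vocabulary (§ "Where the crux rests", kernel-checked instead of prose):
`crux_iff_exactResidue : crux ↔ (0634 → 4738 ∧ 8367 ∧ 1982)` (= `…BareFactorisation.moebiusLimitOfTwoPointLaw_iff_bare₂`,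
p117654) and `exactResidue_of_lineResidue : 0634 → (4738 ∧ 5352 ∧ 5353) → (4738 ∧ 8367 ∧ 1982)` (the line's residue is
at least as strong as the exact one). Verdict unchanged and now read off a theorem: the crux is EXACTLY the conjunction
of three open items of other routes under its own hypothesis; line complete, crux blocked-on stmt-CriticalPhenomena-4738.
-/

noncomputable section

namespace Summit.CriticalPhenomena.Ising3DConformalLimit.Cruxes.MoebiusLimitOfTwoPointLaw.MultipoleWardNonsatEndpoint

open Literature.Probability.LatticeModels Filter Topology MeasureTheory
open Summit.CriticalPhenomena.Ising3DConformalLimit.Theses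

/-! ## Registered stubs -/

/-- **Stub A (`stub_sctOfWard`, LEAD, hardest) — the weak special-conformal Ward identity integrates to finite SCT
covariance along pole-free paths.** For every family `S` normalised off `NonCoincident`, continuous off the diagonals and
satisfying, for every `n`, `b` and every smooth `φ` compactly supported in `NonCoincident 3 n`,
`∫ S_n [(2Δ−6)(Σᵢ⟪b,xᵢ⟫)φ + Dφ(x)[(‖xᵢ‖²b − 2⟪b,xᵢ⟫xᵢ)ᵢ]] = 0` (verbatim the hypothesis of item 5357): for every `a` and
every configuration `x` off the origin whose SCT path `s ↦ SCT_{sa} x` (`s ∈ [0,1]`) does not pass through `∞`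
(`1 + 2s⟪a,xᵢ⟫ + s²‖a‖²‖xᵢ‖² ≠ 0`), `S_n(SCT_a x) = ∏ᵢ (1 + 2⟪a,xᵢ⟫ + ‖a‖²‖xᵢ‖²)^Δ · S_n(x)` where
`SCT_a x = (x + ‖x‖²a)/(1 + 2⟪a,x⟫ + ‖a‖²‖x‖²)` (Di Francesco–Mathieu–Sénéchal 1997 (4.15)–(4.18), (4.52)). Proof route
(`K = ιPι`): with `T(y) := ∏‖yᵢ‖^{-2Δ} S(ιy)` on `({0}ᶜ)ⁿ`, testing the `K_a`-identity against
`x ↦ ∏‖xⱼ‖^{2Δ−6} ψ(ιx)` (`ψ ∈ C_c^∞(({0}ᶜ)ⁿ ∩ NonCoincident)`) and changing variables `x = ιy`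
(`setIntegral_comp_prodSphereInversion`, Jacobian `∏‖yᵢ‖^{-6}`) gives `∫ T(y) Dψ(y)[(a,…,a)] dy = 0`; differentiating
`t ↦ ∫ T(y) ψ(y − ta) dy` under the integral sign this is constancy, hence `T(y + a) = T(y)` whenever the segment
`[y, y+a]` stays in `({0}ᶜ)ⁿ` (continuity of `T` + smooth bumps); and `ι(ιx + a) = SCT_a x`, `‖ιx + a‖² =
(1 + 2⟪a,x⟫ + ‖a‖²‖x‖²)/‖x‖²`. Coincident configurations: both sides vanish (`SCT_a` is injective on its domain). -/
theorem stub_sctOfWard :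
    ∀ (S : CorrFamily 3) (Δ : ℝ), (∀ n z, z ∉ NonCoincident 3 n → S n z = 0) →
      (∀ n, ContinuousOn (S n) (NonCoincident 3 n)) →
      (∀ (n : ℕ) (b : EuclideanSpace ℝ (Fin 3)) (φ : (Fin n → EuclideanSpace ℝ (Fin 3)) → ℝ),
        ContDiff ℝ ((⊤ : ℕ∞) : WithTop ℕ∞) φ → HasCompactSupport φ → tsupport φ ⊆ NonCoincident 3 n →
        ∫ x, S n x * ((2 * Δ - 6) * (∑ i, inner ℝ b (x i)) * φ x +
          fderiv ℝ φ x (fun i => ‖x i‖ ^ 2 • b - (2 * inner ℝ b (x i)) • x i)) = 0) →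
      ∀ (n : ℕ) (a : EuclideanSpace ℝ (Fin 3)) (x : Fin n → EuclideanSpace ℝ (Fin 3)), (∀ i, x i ≠ 0) →
        (∀ i, ∀ s ∈ Set.Icc (0 : ℝ) 1, 1 + 2 * s * inner ℝ a (x i) + s ^ 2 * ‖a‖ ^ 2 * ‖x i‖ ^ 2 ≠ 0) →
        S n (fun i => (1 + 2 * inner ℝ a (x i) + ‖a‖ ^ 2 * ‖x i‖ ^ 2)⁻¹ • (x i + ‖x i‖ ^ 2 • a)) =
          (∏ i, (1 + 2 * inner ℝ a (x i) + ‖a‖ ^ 2 * ‖x i‖ ^ 2) ^ Δ) * S n x :=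
  -- CLOSED (p100147): `Theorems/PrecisionLaplacianMoebiusLimitOfTwoPointLawSCTOfWard.lean`
  PrecisionLaplacianMoebiusLimitOfTwoPointLaw.stub_sctOfWard

/-- **Stub G0 (`stub_reflectInvertOfSCT`) — the reflect-invert maps `J_b = ι ∘ R_b` are words in translations and
SCTs.** For a unit vector `b`, `τ_{−b} ∘ SCT_b ∘ τ_{−b} = ι ∘ R_b` where `R_b y = y − 2⟪b,y⟫b` and `ι y = y/‖y‖²`:
indeed `1 + 2⟪b, y−b⟫ + ‖y−b‖² = ‖y‖²` and `(y − b) + ‖y − b‖²b = y − 2⟪b,y⟫b + ‖y‖²b`, so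
`SCT_b(y − b) − b = R_b y/‖y‖²`. Hence translation invariance + the SCT covariance of stub A give
`S_n((R_b yᵢ/‖yᵢ‖²)ᵢ) = ∏‖yᵢ‖^{2Δ} S_n(y)` whenever every `yᵢ` avoids the point `b` (so `yᵢ − b ≠ 0`) and the closed ray
`{−μb : μ ≥ 0}` (so the SCT path of `yᵢ − b` is pole-free: `1 + 2s⟪b,yᵢ−b⟫ + s²‖yᵢ−b‖² = ‖(1−s)b + s yᵢ‖²`). Pure
algebra. -/
theorem stub_reflectInvertOfSCT :
    ∀ (S : CorrFamily 3) (Δ : ℝ), IsTranslationInvariant S →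
      (∀ (n : ℕ) (a : EuclideanSpace ℝ (Fin 3)) (x : Fin n → EuclideanSpace ℝ (Fin 3)), (∀ i, x i ≠ 0) →
        (∀ i, ∀ s ∈ Set.Icc (0 : ℝ) 1, 1 + 2 * s * inner ℝ a (x i) + s ^ 2 * ‖a‖ ^ 2 * ‖x i‖ ^ 2 ≠ 0) →
        S n (fun i => (1 + 2 * inner ℝ a (x i) + ‖a‖ ^ 2 * ‖x i‖ ^ 2)⁻¹ • (x i + ‖x i‖ ^ 2 • a)) =
          (∏ i, (1 + 2 * inner ℝ a (x i) + ‖a‖ ^ 2 * ‖x i‖ ^ 2) ^ Δ) * S n x) →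
      ∀ (n : ℕ) (b : EuclideanSpace ℝ (Fin 3)), ‖b‖ = 1 → ∀ (y : Fin n → EuclideanSpace ℝ (Fin 3)),
        (∀ i, y i ≠ b) → (∀ i (μ : ℝ), 0 ≤ μ → y i ≠ -(μ • b)) →
        S n (fun i => (‖y i‖ ^ 2)⁻¹ • (y i - (2 * inner ℝ b (y i)) • b)) = (∏ i, (‖y i‖ ^ 2) ^ Δ) * S n y :=
  -- CLOSED (wave 1, p97832): `Theorems/PrecisionLaplacianMoebiusLimitOfTwoPointLawReflectInvertOfSCT.lean`
  PrecisionLaplacianMoebiusLimitOfTwoPointLaw.stub_reflectInvertOfSCT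

/-- **Stub G1 (`stub_scaleOfSCT`) — dilations are words in translations and SCTs.** For `λ > 0` and a unit vector `b`,
`D_{λ²} = τ_{λb} ∘ SCT_{−b/λ} ∘ τ_{(λ−1)b} ∘ SCT_b ∘ τ_{−b}` (as Möbius maps; on every plane through the axis `ℝb` this is
the `PSL₂(ℝ)` identity `E₁₂(λ)E₂₁(−1/λ)E₁₂(λ−1)E₂₁(1)E₁₂(−1) = diag(λ, 1/λ)`). Orbit of a point `x` with `x ∉ ℝ≤0·b`,
`x ≠ b`, `x ≠ b/λ`: `y₁ = x − b`, `y₂ = SCT_b y₁ = b + R_b(x/‖x‖²)` (weight factor `1 + 2⟪b,y₁⟫ + ‖y₁‖² = ‖x‖²`),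
`y₃ = y₂ + (λ−1)b = λb + R_b(x/‖x‖²)`, `y₄ = SCT_{−b/λ} y₃ = λ²x − λb` (weight factor
`1 + 2⟪−b/λ, y₃⟫ + ‖y₃‖²/λ² = 1/(λ²‖x‖²)`; pole-freeness of both SCT paths ⇔ `x ∉ ℝ≤0·b`, `y₃ ≠ 0 ⇔ x ≠ b/λ`),
`y₅ = y₄ + λb = λ²x`; total weight `(‖x‖² · 1/(λ²‖x‖²))^Δ = (λ²)^{−Δ}` per point. All excluded points lie on the line
`ℝb`, so for a configuration first translate by `u = t·d`, `d ⊥ b`, `t` outside finitely many values (translation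
invariance on both sides); coincident configurations: both sides are `0`. Hence `IsScaleCovariant Δ S`. -/
theorem stub_scaleOfSCT :
    ∀ (S : CorrFamily 3) (Δ : ℝ), (∀ n z, z ∉ NonCoincident 3 n → S n z = 0) → IsTranslationInvariant S →
      (∀ (n : ℕ) (a : EuclideanSpace ℝ (Fin 3)) (x : Fin n → EuclideanSpace ℝ (Fin 3)), (∀ i, x i ≠ 0) →
        (∀ i, ∀ s ∈ Set.Icc (0 : ℝ) 1, 1 + 2 * s * inner ℝ a (x i) + s ^ 2 * ‖a‖ ^ 2 * ‖x i‖ ^ 2 ≠ 0) →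
        S n (fun i => (1 + 2 * inner ℝ a (x i) + ‖a‖ ^ 2 * ‖x i‖ ^ 2)⁻¹ • (x i + ‖x i‖ ^ 2 • a)) =
          (∏ i, (1 + 2 * inner ℝ a (x i) + ‖a‖ ^ 2 * ‖x i‖ ^ 2) ^ Δ) * S n x) →
      IsScaleCovariant Δ S :=
  -- CLOSED (wave 1, p99350): `Theorems/PrecisionLaplacianMoebiusLimitOfTwoPointLawScaleOfSCT.lean`
  PrecisionLaplacianMoebiusLimitOfTwoPointLaw.stub_scaleOfSCT

/-- **Stub G3 (`stub_inversionOfReflectInvert`) — the unit inversion is a threefold reflect-invert, up to parity.**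
For an orthonormal frame `{b, w, w'}` of `ℝ³`: `R_w ∘ R_{w'} = −R_b` (orthonormal expansion
`y = ⟪b,y⟫b + ⟪w,y⟫w + ⟪w',y⟫w'`), `J_w ∘ J_{w'} = R_w ∘ R_{w'}` and hence `J_b ∘ J_w ∘ J_{w'} = ι R_b (−R_b) = ι ∘ (−1)`,
with total weight `∏‖xᵢ‖^{2Δ}`. Given a configuration `x` off the origin, choose the unit vector `b` with `⟪xᵢ, b⟫ ≠ 0`
and `b ∉ ℝxᵢ` for all `i` (e.g. `b = b₀/‖b₀‖`, `b₀ = e₂ + t e₀ + s e₁` with `t` off the finitely many values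
`−xᵢ₂/xᵢ₀` (`xᵢ₀ ≠ 0`) and `xᵢ₀/xᵢ₂` (`xᵢ₂ ≠ 0`), then `s` off the values `−(xᵢ₂ + t xᵢ₀)/xᵢ₁` (`xᵢ₁ ≠ 0`); coordinates
`xᵢₖ = xᵢ k`), and complete it to an orthonormal basis `{b, w, w'}`
(`Orthonormal.exists_orthonormalBasis_extension_of_card_eq`, `ι = Fin 3`). Then every point of the chain
`z³ = −x`, `z² = J_{w'} z³ = −R_{w'}xᵢ/‖xᵢ‖²`, `z¹ = J_w z² = −R_wR_{w'}xᵢ = R_b xᵢ`, `J_b z¹ = R_b(R_b xᵢ)/‖xᵢ‖² = xᵢ/‖xᵢ‖² =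
EuclideanGeometry.inversion 0 1 xᵢ` (`inversion_zero_one_eq_smul`) satisfies the hypotheses of the reflect-invert
covariance (a point on the line `ℝw'`, `ℝw` resp. `ℝb` would be orthogonal to `b` resp. parallel to `b`), and the three
weights are `∏‖xᵢ‖^{2Δ}`, `∏‖xᵢ‖^{-2Δ}`, `∏‖xᵢ‖^{2Δ}`; parity removes the initial `−1`. Coincident configurations need no
separate treatment (the reflect-invert identity carries no non-coincidence hypothesis). Hence `IsInversionCovariant Δ S`;
rotations then follow from the LANDED group lemma A0 `stub_inversionBegetsRotations` (item 4675: translations + unit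
inversion ⇒ `O(3)`). -/
theorem stub_inversionOfReflectInvert :
    ∀ (S : CorrFamily 3) (Δ : ℝ), (∀ n z, z ∉ NonCoincident 3 n → S n z = 0) →
      (∀ n (x : Fin n → EuclideanSpace ℝ (Fin 3)), S n (fun i => -(x i)) = S n x) →
      (∀ (n : ℕ) (b : EuclideanSpace ℝ (Fin 3)), ‖b‖ = 1 → ∀ (y : Fin n → EuclideanSpace ℝ (Fin 3)),
        (∀ i, y i ≠ b) → (∀ i (μ : ℝ), 0 ≤ μ → y i ≠ -(μ • b)) →
        S n (fun i => (‖y i‖ ^ 2)⁻¹ • (y i - (2 * inner ℝ b (y i)) • b)) = (∏ i, (‖y i‖ ^ 2) ^ Δ) * S n y) →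
      IsInversionCovariant Δ S :=
  -- CLOSED (wave 1, p98963): `Theorems/PrecisionLaplacianMoebiusLimitOfTwoPointLawInversionOfReflectInvert.lean`
  PrecisionLaplacianMoebiusLimitOfTwoPointLaw.stub_inversionOfReflectInvert

/-- **Stub S5a (`stub_farFieldCoeffContinuous`) — far-field coefficients are continuous (provable-now).** If every
`S_m` is continuous off the diagonals and `‖y‖^{2Δ+1} S_{n+2}(w,y) − ‖y‖A₀(w) − ⟪A₁(w), y/‖y‖⟫ → 0` as `y → ∞`, locally
uniformly in `w ∈ NonCoincident 3 (n+1)` (verbatim the expansion clause of items 5352/5356), then `A₀` and `A₁` are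
continuous on `NonCoincident 3 (n+1)`: averaging the expansion at `y` and `−y` gives
`A₀(w) = lim ½‖y‖^{2Δ}(S_{n+2}(w,y) + S_{n+2}(w,−y))`, and along `y = t eₖ`, `t → +∞`,
`⟪A₁(w), eₖ⟫ = lim ½‖y‖^{2Δ}(S_{n+2}(w,y) − S_{n+2}(w,−y))` — locally uniform limits of functions continuous near any
`w₀` (for `‖y‖` beyond the radius of a neighbourhood of `w₀`, `Fin.snoc w y` stays non-coincident), hence continuous
(`TendstoLocallyUniformlyOn.continuousOn` on small open neighbourhoods; coordinates via `EuclideanSpace.single`). This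
regularity is what makes the integrals in the first-multipole identity honest (Fubini) in stub S5b. -/
theorem stub_farFieldCoeffContinuous :
    ∀ (S : CorrFamily 3) (Δ : ℝ) (n : ℕ) (A₀ : (Fin (n + 1) → EuclideanSpace ℝ (Fin 3)) → ℝ)
      (A₁ : (Fin (n + 1) → EuclideanSpace ℝ (Fin 3)) → EuclideanSpace ℝ (Fin 3)),
      (∀ m, ContinuousOn (S m) (NonCoincident 3 m)) →
      TendstoLocallyUniformlyOn
        (fun (y : EuclideanSpace ℝ (Fin 3)) (w : Fin (n + 1) → EuclideanSpace ℝ (Fin 3)) =>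
          ‖y‖ ^ (2 * Δ + 1) * S (n + 2) (Fin.snoc w y) - ‖y‖ * A₀ w - inner ℝ (A₁ w) (‖y‖⁻¹ • y))
        0 (Filter.cocompact (EuclideanSpace ℝ (Fin 3))) (NonCoincident 3 (n + 1)) →
      ContinuousOn A₀ (NonCoincident 3 (n + 1)) ∧ ContinuousOn A₁ (NonCoincident 3 (n + 1)) :=
  -- CLOSED (wave 1, p97822): `Theorems/PrecisionLaplacianMoebiusLimitOfTwoPointLawFarFieldCoeffContinuous.lean`
  PrecisionLaplacianMoebiusLimitOfTwoPointLaw.stub_farFieldCoeffContinuous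

/-- **Stub S5b (`stub_multipoleToWardOfContinuous`) — item 5356 with continuous far-field coefficients
(provable-now, pure analysis).** First-multipole identity at level `n+1` + monopole/dipole clustering at level `n`, for
CONTINUOUS coefficients `A₀, A₁` (stub S5a), ⇒ the weak special-conformal Ward identity with weight `Δ` for `S_n`. Proof
route (planner-checked): test the level-`(n+1)` identity with `ψ_L(w) = φ(Fin.init w)·χ_L(w (Fin.last n))`,
`χ_L = χ(·/L)`, `χ ≥ 0` a smooth bump supported in `{1 < ‖z‖ < 2}` (e.g. a `ContDiffBump` about `(3/2)e₀` of outer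
radius `< 1/2`), `L` beyond twice the radius of `tsupport φ` so that `tsupport ψ_L ⊆ NonCoincident 3 (n+1)`; split
`∫ dw = ∫∫ dx dz` (`MeasureTheory.volume_preserving_piFinSuccAbove (fun _ => ℝ³) (Fin.last n)` + `integral_prod`, all
integrands continuous with compact support); `Dψ_L(w)[W_b w] = χ_L(z) Dφ(x)[W_b x] + φ(x) ∇χ_L(z)·(‖z‖²b − 2⟪b,z⟫z)`;
the explicit terms `c S_n(x)·2Δ⟪b,z⟫χ_L(z)` on the two sides cancel because
`∫ [(2Δ−6)⟪b,z⟫χ_L + ∇χ_L·(‖z‖²b − 2⟪b,z⟫z)] dz = 2Δ∫⟪b,z⟫χ_L dz` (integration by parts on `ℝ³`,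
`div(‖z‖²b − 2⟪b,z⟫z) = −6⟪b,z⟫`), leaving `c(∫χ_L)·∫ S_n[(2Δ−6)(Σ⟪b,xᵢ⟫)φ + Dφ·W_b] = O((ε_L + ε'_L)L³)` from the
monopole remainder (`≤ ε_L/‖z‖` on `tsupport φ × supp χ_L`, against weights `O(L)` and volume `O(L³)`) and the dipole
remainder (`≤ ε'_L`, against `L³`), with `ε_L, ε'_L → 0` by local uniformity on the compact `tsupport φ`
(`TendstoLocallyUniformlyOn` + `Filter.cocompact` / `Metric.cocompact_eq`); since `∫χ_L = L³∫χ` and `c ≠ 0`, the Ward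
integral is `0`. -/
theorem stub_multipoleToWardOfContinuous :
    ∀ (S : CorrFamily 3) (c Δ : ℝ), c ≠ 0 → (∀ n, ContinuousOn (S n) (NonCoincident 3 n)) →
      (∀ n : ℕ, ∃ (A₀ : (Fin (n + 1) → EuclideanSpace ℝ (Fin 3)) → ℝ)
          (A₁ : (Fin (n + 1) → EuclideanSpace ℝ (Fin 3)) → EuclideanSpace ℝ (Fin 3)),
        ContinuousOn A₀ (NonCoincident 3 (n + 1)) ∧ ContinuousOn A₁ (NonCoincident 3 (n + 1)) ∧
        (∀ (b : EuclideanSpace ℝ (Fin 3)) (ψ : (Fin (n + 1) → EuclideanSpace ℝ (Fin 3)) → ℝ),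
          ContDiff ℝ ((⊤ : ℕ∞) : WithTop ℕ∞) ψ → HasCompactSupport ψ → tsupport ψ ⊆ NonCoincident 3 (n + 1) →
          ∫ w, inner ℝ (A₁ w) b * ψ w =
            ∫ w, A₀ w * ((2 * Δ - 6) * (∑ i, inner ℝ b (w i)) * ψ w +
              fderiv ℝ ψ w (fun i => ‖w i‖ ^ 2 • b - (2 * inner ℝ b (w i)) • w i))) ∧
        TendstoLocallyUniformlyOn
          (fun (z : EuclideanSpace ℝ (Fin 3)) (x : Fin n → EuclideanSpace ℝ (Fin 3)) =>
            ‖z‖ * (A₀ (Fin.snoc x z) - c * S n x))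
          0 (Filter.cocompact (EuclideanSpace ℝ (Fin 3))) (NonCoincident 3 n) ∧
        TendstoLocallyUniformlyOn
          (fun (z : EuclideanSpace ℝ (Fin 3)) (x : Fin n → EuclideanSpace ℝ (Fin 3)) =>
            A₁ (Fin.snoc x z) - (2 * Δ * c * S n x) • z)
          0 (Filter.cocompact (EuclideanSpace ℝ (Fin 3))) (NonCoincident 3 n)) →
      ∀ (n : ℕ) (b : EuclideanSpace ℝ (Fin 3)) (φ : (Fin n → EuclideanSpace ℝ (Fin 3)) → ℝ),
        ContDiff ℝ ((⊤ : ℕ∞) : WithTop ℕ∞) φ → HasCompactSupport φ → tsupport φ ⊆ NonCoincident 3 n →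
        ∫ x, S n x * ((2 * Δ - 6) * (∑ i, inner ℝ b (x i)) * φ x +
          fderiv ℝ φ x (fun i => ‖x i‖ ^ 2 • b - (2 * inner ℝ b (x i)) • x i)) = 0 :=
  -- CLOSED (p105438): `Theorems/PrecisionLaplacianMoebiusLimitOfTwoPointLawMultipoleToWardOfContinuous.lean`
  PrecisionLaplacianMoebiusLimitOfTwoPointLaw.stub_multipoleToWardOfContinuous

/-- **Item stmt-CriticalPhenomena-5356 `PrimaryAtInfinity.MultipoleToWard` from stubs S5a + S5b** (pure logic: S5a
supplies the continuity of the far-field coefficients from the expansion clause, S5b does the analysis). -/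
theorem stub_multipoleToWard : PrimaryAtInfinity.MultipoleToWard := by
  intro S c Δ hc hcont hFF
  refine stub_multipoleToWardOfContinuous S c Δ hc hcont fun m => ?_
  obtain ⟨A₀, A₁, hE, hI, hM, hD⟩ := hFF m
  have hA := stub_farFieldCoeffContinuous S Δ m A₀ A₁ hcont hE
  exact ⟨A₀, A₁, hA.1, hA.2, hI, hM, hD⟩

/-- **Stub E (`stub_regularOfLimitExists`, lead c2, provable-now) — the regularity package of item 5355 is free.**
Item stmt-CriticalPhenomena-4738 `WeylWindow.LimitExists` (`∃ ρ S`, `ρ > 0` on `(0,1]`,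
`HasPointwiseScalingLimit (criticalCorr 3) ρ S`, `IsNondegenerateTwoPoint S`) ⇒ item stmt-CriticalPhenomena-5355
`PrimaryAtInfinity.ExistsRegularLimit`: truncate `S` to `0` off `NonCoincident` (the limit only sees non-coincident
configurations, `TendstoLocallyUniformlyOn.congr_right`); translation invariance, parity and continuity off the
diagonals of ANY pointwise limit of the critical `ℤ³` correlators are the landed `MoebiusLimitExistsNegative.limit_translate`
(meshes `t/(k+1)`, lattice translation invariance of the plus state), `MoebiusLimitExistsNegative.limit_neg` (generic
translate off the grid + lattice point reflection) and `LimitMeshContinuity.continuousOn_limit` (good-mesh argument).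
So the line's existence hypothesis is exactly bare existence, which the crux's conclusion itself implies. -/
theorem stub_regularOfLimitExists : WeylWindow.LimitExists → PrimaryAtInfinity.ExistsRegularLimit :=
  -- CLOSED (lead c2, p115643): `Theorems/PrecisionLaplacianMoebiusLimitOfTwoPointLawRegularOfLimitExists.lean`
  PrecisionLaplacianMoebiusLimitOfTwoPointLaw.stub_regularOfLimitExists

/-! ## Kernel-checked composition (no `sorry` below this line) -/

/-- **Item 5357 from the stubs.** `WardToMoebius` ⇐ A (SCT covariance from the Ward identity) + G0 (reflect-inverts)
+ G1 (dilations) + G3 (unit inversion, using parity) + the landed group lemma A0 (item 4675, p86170: translations + unit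
inversion ⇒ `O(3)`): `IsMoebiusCovariant Δ S = (translations ∧ O(3)) ∧ dilations ∧ inversion`, translations being a
hypothesis. Pure logic. -/
theorem wardToMoebius_of_stubs : PrimaryAtInfinity.WardToMoebius := by
  intro S Δ hnorm hcont htr hpar hK
  have hsct := stub_sctOfWard S Δ hnorm hcont hK
  have hJ := stub_reflectInvertOfSCT S Δ htr hsct
  have hinv : IsInversionCovariant Δ S := stub_inversionOfReflectInvert S Δ hnorm hpar hJ
  have hrot : IsRotationInvariant S :=
    PrecisionLaplacianMoebiusLimitOfTwoPointLaw.stub_inversionBegetsRotations Δ S htr hinv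
  exact ⟨⟨htr, hrot⟩, stub_scaleOfSCT S Δ hnorm htr hsct, hinv⟩

/-- **The line concludes the crux BY NAME (v3).** Items stmt-CriticalPhenomena-4738 `WeylWindow.LimitExists` (bare
existence, necessary), 5352 `FirstMultipoleIdentity`, 5353 `FarFieldClustering` (open problems, staffed on their home
routes) BY NAME as hypotheses; stub E turns 4738 into 5355, and lead 1's landed edge
`moebiusLimitOfTwoPointLaw_of_primaryAtInfinity_sharp` (p101387, no `NonSaturation`) is composed with the two analysis
items built on this line (`stub_multipoleToWard` = 5356, `wardToMoebius_of_stubs` = 5357). -/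
theorem MoebiusLimitOfTwoPointLaw_of
    (hL : WeylWindow.LimitExists)
    (hM1 : PrimaryAtInfinity.FirstMultipoleIdentity) (hFC : PrimaryAtInfinity.FarFieldClustering) :
    PrecisionLaplacian.MoebiusLimitOfTwoPointLaw :=
  PrecisionLaplacianMoebiusLimitOfTwoPointLaw.moebiusLimitOfTwoPointLaw_of_primaryAtInfinity_sharp
    (stub_regularOfLimitExists hL) hM1 hFC stub_multipoleToWard wardToMoebius_of_stubs

/-- The same under the second host route's spelling (`BernsteinTemperature.MoebiusLimitOfTwoPointLaw`, identical
definiens). -/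
theorem MoebiusLimitOfTwoPointLaw_of'
    (hL : WeylWindow.LimitExists)
    (hM1 : PrimaryAtInfinity.FirstMultipoleIdentity) (hFC : PrimaryAtInfinity.FarFieldClustering) :
    BernsteinTemperature.MoebiusLimitOfTwoPointLaw :=
  MoebiusLimitOfTwoPointLaw_of hL hM1 hFC

/-- The v2 composition (lead c1) remains available: the four open items 1342/5355/5352/5353 by name. -/
theorem MoebiusLimitOfTwoPointLaw_of_v2
    (hNS : PerfectScreening.NonSaturation) (hE : PrimaryAtInfinity.ExistsRegularLimit)
    (hM1 : PrimaryAtInfinity.FirstMultipoleIdentity) (hFC : PrimaryAtInfinity.FarFieldClustering) :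
    PrecisionLaplacian.MoebiusLimitOfTwoPointLaw :=
  PrecisionLaplacianMoebiusLimitOfTwoPointLaw.moebiusLimitOfTwoPointLaw_of_primaryAtInfinity hNS hE hM1 hFC
    stub_multipoleToWard wardToMoebius_of_stubs

/-- **The existence hypothesis of v3 is necessary.** Under the crux's own hypothesis (item 0634) the crux gives back
item 4738: `MoebiusLimitOfTwoPointLaw → IsingEuclidUpgradeR2RotInvPowerLaw → LimitExists` (forget `Δ` and the Möbius
covariance of the limit). So among the three hypotheses of `MoebiusLimitOfTwoPointLaw_of` only 5352/5353 can carry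
surplus. -/
theorem limitExists_of_crux (h : PrecisionLaplacian.MoebiusLimitOfTwoPointLaw)
    (hP : IsingEuclidUpgrade.IsingEuclidUpgradeR2RotInvPowerLaw) : WeylWindow.LimitExists := by
  obtain ⟨ρ, _, S, hρ, _, hlim, hnd, _⟩ := h hP
  exact ⟨ρ, S, hρ, hlim, hnd⟩
/-! ## Where the crux rests (lead c2): the line's residue versus the exact residue

LANDED alongside this skeleton (`--supports stmt-CriticalPhenomena-4801`):

* `Theorems/PrecisionLaplacianMoebiusLimitOfTwoPointLawBareExistence.lean` (p116785):
  `existsScaleCovariantLimit_of_limitExists : 0634 → 4738 → 1981` (under the two-point law bare existence gives the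
  scale-covariant regular limit of item 1981; `existsScaleCovariantLimit_iff_limitExists : 0634 → (1981 ↔ 4738)`),
  `limitRotationInvariant_of_rotationUpgradeFromTwoPoint : 0634 → 8367 → 1980` (the two-point isotropy hypothesis of
  item 8367 is discharged by `twoPoint_of_limit`), and the compositions
  `moebiusLimitOfTwoPointLaw_of_bare : 4738 → 1980 → 1982 → crux`, `moebiusLimitOfTwoPointLaw_of_bare₂ : 4738 → 8367 → 1982 → crux`;
* `Theorems/PrecisionLaplacianMoebiusLimitOfTwoPointLawBareFactorisation.lean` (p117654, LANDED; registered sub-goal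
  `moebiusLimitOfTwoPointLaw_iff_bare`): `moebiusLimitOfTwoPointLaw_iff_bare : crux ↔ (0634 → 4738 ∧ 1980 ∧ 1982)` and
  `moebiusLimitOfTwoPointLaw_iff_bare₂ : crux ↔ (0634 → 4738 ∧ 8367 ∧ 1982)` — the EXACT residue of the crux through existing
  items, each factor necessary given 0634. (A v3.1 of this skeleton re-exporting it as `crux_iff_exactResidue` +
  `exactResidue_of_lineResidue` is in the lead's folder, `work/MoebiusLimitOfTwoPointLaw.v31.lean`; it only waits for the hub olean
  of that module.)
* `Theorems/PrecisionLaplacianMoebiusLimitOfTwoPointLawLimitExistsEdge.lean` (p116900, LANDED; registered sub-goal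
  `moebiusLimitOfTwoPointLaw_of_limitExists`): this skeleton's `_of` as a tree theorem, `4738 → 5352 → 5353 → crux`, plus
  `limitExists_of_moebiusLimitOfTwoPointLaw` (4738 necessary given 0634).

So the line's residue (4738 ∧ 5352 ∧ 5353) implies the exact residue (4738 ∧ 8367 ∧ 1982) under 0634 (through the crux
itself); its surplus is the far-field expansion structure written into 5352/5353. All five items are open problems on
their home routes; no Lean debt remains on this line. -/


/-- **The exact residue of the crux (lead c3 re-export of p117654).** Under its own hypothesis (item 0634) the crux is
EQUIVALENT to the conjunction of items stmt-CriticalPhenomena-4738 `WeylWindow.LimitExists` (bare existence of a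
non-degenerate pointwise limit), stmt-CriticalPhenomena-8367 `GaussianScaleMixture.RotationUpgradeFromTwoPoint` (`O(3)`
upgrade of every such limit from two-point isotropy) and stmt-CriticalPhenomena-1982
`HyperoctahedralRP.InversionUpgradeNormalised` (unit-inversion upgrade of every normalised Euclidean scale-covariant
limit). Each factor is necessary. -/
theorem crux_iff_exactResidue :
    PrecisionLaplacian.MoebiusLimitOfTwoPointLaw ↔
      (IsingEuclidUpgrade.IsingEuclidUpgradeR2RotInvPowerLaw →
        WeylWindow.LimitExists ∧ GaussianScaleMixture.RotationUpgradeFromTwoPoint ∧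
          HyperoctahedralRP.InversionUpgradeNormalised) :=
  PrecisionLaplacianMoebiusLimitOfTwoPointLaw.moebiusLimitOfTwoPointLaw_iff_bare₂

/-- **The line's residue implies the exact residue** (through the crux itself): under item 0634,
`4738 ∧ 5352 ∧ 5353 → 4738 ∧ 8367 ∧ 1982`. The surplus of the line's hypotheses over the exact residue is the
far-field expansion structure written into items 5352/5353. -/
theorem exactResidue_of_lineResidue (hP : IsingEuclidUpgrade.IsingEuclidUpgradeR2RotInvPowerLaw)
    (h : WeylWindow.LimitExists ∧ PrimaryAtInfinity.FirstMultipoleIdentity ∧ PrimaryAtInfinity.FarFieldClustering) :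
    WeylWindow.LimitExists ∧ GaussianScaleMixture.RotationUpgradeFromTwoPoint ∧
      HyperoctahedralRP.InversionUpgradeNormalised :=
  crux_iff_exactResidue.mp (MoebiusLimitOfTwoPointLaw_of h.1 h.2.1 h.2.2) hP

/-- **The skeleton's `_of` is a tree theorem** (lead c2, p116900,
`Theorems/PrecisionLaplacianMoebiusLimitOfTwoPointLawLimitExistsEdge.lean`): re-export, so that readers of this line
file can cite the landed name. -/
theorem MoebiusLimitOfTwoPointLaw_of_tree
    (hL : WeylWindow.LimitExists)
    (hM1 : PrimaryAtInfinity.FirstMultipoleIdentity) (hFC : PrimaryAtInfinity.FarFieldClustering) :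
    PrecisionLaplacian.MoebiusLimitOfTwoPointLaw :=
  PrecisionLaplacianMoebiusLimitOfTwoPointLaw.moebiusLimitOfTwoPointLaw_of_limitExists hL hM1 hFC

end Summit.CriticalPhenomena.Ising3DConformalLimit.Cruxes.MoebiusLimitOfTwoPointLaw.MultipoleWardNonsatEndpoint

end
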